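import Literature.NumberTheory.EllipticCurves.TateModulePontryaginDualCharpolyProofs
import Literature.NumberTheory.EllipticCurves.JetchevSkinnerWan2017.SigmaLocalFinitelyDecomposedProofs
import Literature.NumberTheory.GaloisRepresentations.UnramifiedInertiaCocycleFrobeniusTwistProofs
import Literature.NumberTheory.GaloisRepresentations.ContinuousCorestriction
import Literature.NumberTheory.EllipticCurves.SigmaEulerFactorIntrinsicBridgeProofs
import Literature.NumberTheory.EllipticCurves.JetchevSkinnerWan2017.SigmaImprimitiveCharIdeal
import Literature.NumberTheory.EllipticCurves.HasseWeilGoodReductionProofs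
import Literature.NumberTheory.EllipticCurves.BigGaloisRepSelmer
import Literature.NumberTheory.EllipticCurves.ZpExtensionUnramifiedProofs
import Literature.NumberTheory.GaloisRepresentations.DecompositionGroupOfCompletion
import Literature.NumberTheory.GaloisRepresentations.LocalGaloisGroupProofs
import Literature.NumberTheory.Automorphic.AdicCompletionResidueCard
import Literature.NumberTheory.Automorphic.AdicCompletionLocalField
import HarnessLib

/-!
# (S5-good) inputs for the local `Σ`-atom: `res φ_w` is an arithmetic Frobenius at `𝔓₀ ∣ w`,
# `q_w ∈ ℤ_p^×`, `E[p^∞]` is unramified at a good `w ∤ p` in the LOCAL currency, and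
# `charpoly (q_w⁻¹ • ρ_{E,p}(σ_w) | T_p E) = X² − (a_w/q_w)X + 1/q_w` (theorems only)

Cell `bsd-stepL`, K2 route `ErratumRoadFive`, support item 20495 `JSWSigmaLocalCharIdeal`
(`JetchevSkinnerWan2017.sigmaLocal_charIdeal_eulerFactor_mem_of_noTamagawaDefect`), step (S5) of the
L5 plan at the finitely decomposed places of GOOD reduction; seat `bsd-stepL-imc-p1` (g14).
THEOREMS ONLY (no definition, no named fact, no `sorry`).

* §1 `charpoly_eq_charpoly_unitsInv_smul_of_nsmul_semiconj` — linear algebra: `q • Φ ∘ F = M ∘ Φ` with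
  `q = n` a unit ⇒ `charpoly F = charpoly (n⁻¹ • M)`; `tateModule_map_bijective_of_addEquiv`.
* §2 `primaryTorsionGaloisRep_localMap_eq_of_mem_absInertia` — Silverman VII.4.1(a) for `E[p^∞]` and
  the local inertia group `absInertia K_w` through `localMap K (inl w)` (`I_{𝔓₀} = res I_{K_w}`).
* §3 `isArithFrobAt_localMap_of_isFrobPow` (local Frobenius ↦ arithmetic Frobenius at
  `adicCompletionPrime K w`), `isUnit_residueFieldCard_padicInt`, the three spellings of `q_w`.
* §4 `charpoly_unitsInv_smul_galoisRepTate_of_hasGoodReductionAt` — from the tree's PROVED trace ∕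
  determinant of Frobenius (`…_of_hasGoodReductionAt_holds`) and `rank T_p E = 2`.

Consumed by `ErratumRoadFiveSigmaLocalGoodCharpoly` (the transport
`charpoly Lt = charpoly T_p(φ·) = charpoly (q_w⁻¹ • ρ(σ_w))` and the Euler-factor membership of `hS5`).

References: [GreenbergVatsal2000] §2, proof of Prop. 2.4 (arXiv p. 22); [SilvermanAEC2009] VII.4.1,
C.21 Remark 21.3; [NeukirchANT1999] II (9.6); [Skinner2016PacificMC] §2.3.
-/

noncomputable section

open scoped Classical
open Polynomial Field NumberField IsDedekindDomain WeierstrassCurve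
open Literature.NumberTheory.EllipticCurves Literature.NumberTheory.GaloisRepresentations
  Literature.NumberTheory.EllipticCurves.BigGaloisRep
  Literature.NumberTheory.GaloisRepresentations.IsNonarchimedeanLocalField
  Literature.NumberTheory.EllipticCurves.JetchevSkinnerWan2017 Literature.NumberTheory.EllipticCurves.IwasawaCharacter

set_option autoImplicit false
-- the Theorems namespace of this sub repeats the summit name by design (D-0017 nested layout)
set_option linter.dupNamespace false

namespace Summit.BirchSwinnertonDyer.BirchSwinnertonDyer.Theorems.SigmaLocal

/-! ## §1 Generic linear-algebra ∕ Tate-module lemmas -/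

section Generic

variable {p : ℕ} [Fact p.Prime]

/-- **Intertwining up to a unit scalar**: if `Φ : X ≃ Y` satisfies `q • Φ(F t) = M(Φ t)` with `q` a
unit `n` of `R`, then `charpoly F = charpoly (n⁻¹ • M)`. [folklore] -/
theorem charpoly_eq_charpoly_unitsInv_smul_of_nsmul_semiconj {R : Type*} [CommRing R]
    {X Y : Type*} [AddCommGroup X] [Module R X] [AddCommGroup Y] [Module R Y]
    [Module.Free R X] [Module.Finite R X] [Module.Free R Y] [Module.Finite R Y]
    (Φ : X ≃ₗ[R] Y) (F : X →ₗ[R] X) (M : Y →ₗ[R] Y) (q : ℕ) (n : Rˣ) (hn : (n : R) = q)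
    (h : ∀ t, q • Φ (F t) = M (Φ t)) :
    F.charpoly = ((↑n⁻¹ : R) • M).charpoly := by
  have hconj : Φ.conj F = (↑n⁻¹ : R) • M := by
    apply LinearMap.ext
    intro y
    obtain ⟨t, rfl⟩ := Φ.surjective y
    rw [LinearEquiv.conj_apply, LinearMap.comp_apply, LinearMap.comp_apply, LinearEquiv.coe_coe,
      LinearEquiv.coe_coe, Φ.symm_apply_apply, LinearMap.smul_apply, ← h t, ← Nat.cast_smul_eq_nsmul R,
      ← hn, smul_smul, Units.inv_mul, one_smul]
  rw [← hconj, LinearEquiv.charpoly_conj]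

/-- `T_p` of an additive isomorphism is bijective. [folklore] -/
theorem tateModule_map_bijective_of_addEquiv {M N : Type*} [AddCommGroup M] [AddCommGroup N]
    (e : M ≃+ N) : Function.Bijective (TateModule.map p e.toAddMonoidHom) :=
  TateModule.map_bijective_of_injective_of_forall_mem_range _ e.injective
    fun b _ _ => ⟨e.symm b, e.apply_symm_apply b⟩

end Generic

/-! ## §2 `E[p^∞]` is unramified at a good place `w ∤ p`, in the local currency -/

section Unramified

variable {K : Type} [Field K] [NumberField K] (E : WeierstrassCurve K) [E.IsElliptic]
  (p : ℕ) [Fact p.Prime] {w : HeightOneSpectrum (𝓞 K)}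

/-- **Silverman VII.4.1(a) in the local currency**: at a place `w ∤ p` of good reduction the local
inertia group `absInertia K_w`, acting on `E[p^∞] = PrimaryTorsion (geomPoints E) p` through
`localMap K (inl w) = absGaloisRestrict K K_w`, acts trivially (`I_{𝔓₀} = res(I_{K_w})`,
`inertia_adicCompletionPrime_eq_map_absInertia`). [cite: SilvermanAEC2009, Prop. VII.4.1(a)]
[cite: NeukirchANT1999, Ch. II §9 Prop. (9.6)] -/
theorem primaryTorsionGaloisRep_localMap_eq_of_mem_absInertia (hv : E.HasGoodReductionAt w)
    (hw : ((p : ℕ) : 𝓞 K) ∉ w.asIdeal)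
    {σ : absoluteGaloisGroup (w.adicCompletion K)} (hσ : σ ∈ absInertia (w.adicCompletion K))
    (a : PrimaryTorsion (geomPoints E) p) :
    ((E.primaryTorsionGaloisRep p).restrict (localMap K (Sum.inl w)) :
      ContinuousRep (absoluteGaloisGroup (w.adicCompletion K)) ℤ_[p]
        (PrimaryTorsion (geomPoints E) p)) σ a = a := by
  obtain ⟨k, hk⟩ := a.exists_pow_smul_eq_zero
  have hτ : localMap K (Sum.inl w) σ ∈
      (adicCompletionPrime K w).inertia (absoluteGaloisGroup K) := by
    rw [inertia_adicCompletionPrime_eq_map_absInertia]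
    exact Subgroup.mem_map_of_mem _ hσ
  have hpk : ((p ^ k : ℕ) : 𝓞 K) ∉ w.asIdeal := w.natCast_pow_not_mem hw k
  apply PrimaryTorsion.ext
  change (localMap K (Sum.inl w) σ) • (a : geomPoints E) = a
  exact E.smul_eq_of_mem_inertia_of_nsmul_eq_zero hv hpk (adicCompletionPrime_mem_primesAbove K w) hτ hk

end Unramified

/-! ## §3 The Frobenius of the Euler datum is an arithmetic Frobenius at `𝔓₀ ∣ w` -/

section Frobenius

variable {K : Type} [Field K] [NumberField K] {w : HeightOneSpectrum (𝓞 K)}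

/-- **`res(φ)` is an arithmetic Frobenius at `𝔓₀ = adicCompletionPrime K w`** for a local Frobenius `φ`
(`IsFrobPow φ 1`) of `K_w`, `res = localMap K (inl w) = absGaloisRestrict K K_w` (Neukirch II (9.6);
`isArithFrobAt_absGaloisRestrict_adicCompletionPrime_iff`, `isFrobPow_one_iff_isAbsArithFrob_holds`,
`residueFieldCard_adicCompletion_eq`). [cite: NeukirchANT1999, Ch. II §9 Prop. (9.6)] -/
theorem isArithFrobAt_localMap_of_isFrobPow {φ : absoluteGaloisGroup (w.adicCompletion K)}
    (hφ : IsFrobPow φ 1) :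
    IsArithFrobAt (𝓞 K) (localMap K (Sum.inl w) φ) (adicCompletionPrime K w) := by
  have hq : residueFieldCard (w.adicCompletion K) = Nat.card (𝓞 K ⧸ w.asIdeal) := by
    rw [Literature.NumberTheory.Automorphic.residueFieldCard_adicCompletion_eq, HeightOneSpectrum.residueCard_eq_card_quotient]
  exact (isArithFrobAt_absGaloisRestrict_adicCompletionPrime_iff K w hq φ).mpr
    (isFrobPow_one_iff_isAbsArithFrob_holds.mp hφ)

/-- `q_w = #k_w` is a `p`-adic unit for `w ∤ p` (a power of the residue characteristic `ℓ ≠ p`).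
[folklore] -/
theorem isUnit_residueFieldCard_padicInt {p : ℕ} [Fact p.Prime] (hw : ((p : ℕ) : 𝓞 K) ∉ w.asIdeal) :
    IsUnit ((residueFieldCard (w.adicCompletion K) : ℕ) : ℤ_[p]) := by
  obtain ⟨f, -, hf⟩ := residueFieldCard_eq_pow_ringChar (w.adicCompletion K)
  rw [hf, Nat.cast_pow]
  refine IsUnit.pow _ ?_
  rw [PadicInt.isUnit_iff, PadicInt.norm_natCast_eq_one_iff, Nat.coprime_primes (Fact.out : p.Prime)
    (ringChar_residueField_prime (F := w.adicCompletion K))]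
  exact Ne.symm (w.ringChar_residueField_adicCompletion_ne hw)

/-- The three spellings of `q_w` agree: `residueFieldCard K_w = #k_w` (residue field of
`w.adicCompletionIntegers K`). [folklore] -/
theorem residueFieldCard_eq_natCard_residueField :
    residueFieldCard (w.adicCompletion K) =
      Nat.card (IsLocalRing.ResidueField (w.adicCompletionIntegers K)) := by
  rw [Literature.NumberTheory.Automorphic.residueFieldCard_adicCompletion_eq, natCard_residueField_eq_residueCard]

/-- `residueFieldCard K_w = absNorm w`. [folklore] -/
theorem residueFieldCard_eq_absNorm :
    residueFieldCard (w.adicCompletion K) = Ideal.absNorm w.asIdeal := by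
  rw [Literature.NumberTheory.Automorphic.residueFieldCard_adicCompletion_eq, HeightOneSpectrum.residueCard_eq_card_quotient, Ideal.absNorm_apply,
    Submodule.cardQuot_apply]

end Frobenius

/-! ## §4 `charpoly (q_w⁻¹ • ρ_{E,p}(σ_w) | T_p E) = X² − (a_w/q_w) X + 1/q_w` at a good `w ∤ p` -/

section ScaledCharpoly

variable {K : Type} [Field K] [NumberField K] (E : WeierstrassCurve K) [E.IsElliptic]
  (p : ℕ) [Fact p.Prime] {w : HeightOneSpectrum (𝓞 K)}

/-- **The scaled Frobenius on `T_p E`**: at a place `w ∤ p` of good reduction, for an arithmetic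
Frobenius `σ` at a prime `𝔓 ∣ w` and a `p`-adic unit `n` with `↑n = q_w`,
`charpoly (n⁻¹ • ρ_{E,p}(σ)) = X² − (a_w n⁻¹) X + n⁻¹` (trace `a_w` and determinant `q_w` of Frobenius,
`trace_/det_galoisRepTate_frobenius_of_hasGoodReductionAt_holds`; `rank T_p E = 2`).
[cite: SilvermanAEC2009, C.21 Remark 21.3] [cite: GreenbergVatsal2000, §2, proof of Prop. 2.4 (arXiv p. 22)] -/
theorem charpoly_unitsInv_smul_galoisRepTate_of_hasGoodReductionAt
    (hw : ((p : ℕ) : 𝓞 K) ∉ w.asIdeal) (hv : E.HasGoodReductionAt w)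
    {𝔓 : Ideal (absIntegers (𝓞 K) K)} (h𝔓 : 𝔓 ∈ w.primesAbove)
    {σ : absoluteGaloisGroup K} (hσ : IsArithFrobAt (𝓞 K) σ 𝔓) (n : ℤ_[p]ˣ)
    (hn : (n : ℤ_[p]) = Nat.card (IsLocalRing.ResidueField (w.adicCompletionIntegers K))) :
    haveI := module_free_tateModule_holds E p
    haveI := module_finite_tateModule_holds E p
    ((↑n⁻¹ : ℤ_[p]) • E.galoisRepTate p σ).charpoly =
      X ^ 2 - C ((E.frobeniusTraceAt w : ℤ_[p]) * ↑n⁻¹) * X + C (↑n⁻¹ : ℤ_[p]) := by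
  haveI := module_free_tateModule_holds E p
  haveI := module_finite_tateModule_holds E p
  have hpK : (p : K) ≠ 0 := by exact_mod_cast (Fact.out : p.Prime).ne_zero
  have htr := E.trace_galoisRepTate_frobenius_of_hasGoodReductionAt_holds p w hw hv h𝔓 hσ
  have hdet := E.det_galoisRepTate_frobenius_of_hasGoodReductionAt_holds p w hw hv h𝔓 hσ
  rw [charpoly_tateModule_eq hpK, map_smul, LinearMap.det_smul, finrank_tateModule_eq_two_holds E p hpK,
    htr, hdet, ← hn, smul_eq_mul, mul_comm (↑n⁻¹ : ℤ_[p]) (E.frobeniusTraceAt w : ℤ_[p]),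
    pow_two (↑n⁻¹ : ℤ_[p]), mul_assoc, Units.inv_mul, mul_one]

end ScaledCharpoly

end Summit.BirchSwinnertonDyer.BirchSwinnertonDyer.Theorems.SigmaLocal

end
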